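import Summits.CriticalPhenomena.PercolationContinuityZ3.Theorems.PercNearOneGluingNoHeavyLowerTailStarSetGateExpansion
import Summits.CriticalPhenomena.PercolationContinuityZ3.Theorems.PercNearOneGluingNoHeavyLowerTailStarSetLinkRepresentation
import HarnessLib

/-!
# `NoHeavyLowerTail` (stmt-CriticalPhenomena-4575) — the STATE expansion of the separated margin of a two-port star family (shared ports allowed)

Support file (prover `prim-gen-swap` gen 7; `--supports stmt-CriticalPhenomena-4575`).  No definitions, no named facts, no sorries.

`StarSet.setCSdiff_gate_expansion` (…StarSetGateExpansion) expands `CSdiff_w(S; c)` of a family of two-port pendant stars over the joint states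
`t : Fin m → Bool × Bool` of the port pairs, assuming the `2m` ports pairwise distinct (the gate set then determines the state).  This file proves
the SAME identity without any distinctness of ports across stars, by partitioning directly by the state `T(ω)` of the port pairs instead of by
the gate set:

* `StarSet.real_stateClass_eq` — `μ_w{T = t} = ι(t) = Π_i (β_i | 1−β_i)(β_i' | 1−β_i')`;
* `StarSet.setCSdiff_state_expansion` — `μ_w(c ↮ S, |π(c)| ≤ j) − μ_w(c ↮ S, 1 ≤ |π(S)| ≤ j)
  = Σ_t ι(t)·[μ_w(c ↮' Y(t), |π'(c)| ≤ j) − μ_w(c ↮' Y(t), 1 ≤ |π'(Y(t))| ≤ j)]`, primes read off the stars, `Y(t)` the port set of `t`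
  (ports of different stars may coincide: FOREST port graphs, seat memo R3-SEATS.md §9).
-/

noncomputable section

namespace Summit.CriticalPhenomena.PercolationContinuityZ3.Theorems

open MeasureTheory Set Literature.Probability.LatticeModels Literature.Probability.Percolation
open scoped Classical BigOperators

variable {n m : ℕ}

namespace StarSet

/-- **Probability of a state class.**  `μ_w{T = t} = Π_i (β_i | 1−β_i)·(β_i' | 1−β_i')` for the state `T(ω)` of the `2m` port pairs
(`p i ≠ p' i`, star centres pairwise distinct and off the ports). [folklore] -/
theorem real_stateClass_eq (w : Sym2 (Fin n) → unitInterval) (s p p' : Fin m → Fin n) (t : Fin m → Bool × Bool)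
    (hs : Function.Injective s) (hps : ∀ i k, p i ≠ s k) (hp's : ∀ i k, p' i ≠ s k) (hpp' : ∀ i, p i ≠ p' i) :
    (prodBernoulli w).real {ω : BondConfig (Fin n) |
        (fun i => (decide (s(s i, p i) ∈ ω), decide (s(s i, p' i) ∈ ω))) = t} =
      ∏ i, ((if (t i).1 then (w s(s i, p i) : ℝ) else 1 - w s(s i, p i)) *
        (if (t i).2 then (w s(s i, p' i) : ℝ) else 1 - w s(s i, p' i))) := by
  haveI : IsProbabilityMeasure (prodBernoulli w) := inferInstance
  set μ := prodBernoulli w with hμ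
  set C : Fin m → Set (BondConfig (Fin n)) :=
    fun i => {ω | (s(s i, p i) ∈ ω ↔ (t i).1 = true) ∧ (s(s i, p' i) ∈ ω ↔ (t i).2 = true)} with hC
  have hclass : {ω : BondConfig (Fin n) | (fun i => (decide (s(s i, p i) ∈ ω), decide (s(s i, p' i) ∈ ω))) = t} =
      Set.univ ∩ ⋂ i ∈ (Finset.univ : Finset (Fin m)), C i := by
    ext ω
    simp only [mem_setOf_eq, mem_inter_iff, mem_univ, true_and, mem_iInter, Finset.mem_univ, forall_true_left, hC]
    constructor
    · intro h i
      have hi := congrFun h i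
      simp only [Prod.ext_iff] at hi
      constructor
      · rw [← hi.1]; simp only [decide_eq_true_eq]
      · rw [← hi.2]; simp only [decide_eq_true_eq]
    · intro h
      funext i
      refine Prod.ext ?_ ?_
      · simp only
        rw [Bool.eq_iff_iff, decide_eq_true_eq]; exact (h i).1
      · simp only
        rw [Bool.eq_iff_iff, decide_eq_true_eq]; exact (h i).2
  rw [hclass]
  have hne : ∀ i, (s(s i, p i) : Sym2 (Fin n)) ≠ s(s i, p' i) := fun i h => hpp' i (Sym2.congr_right.1 h)
  have hSdisj : (↑(Finset.univ : Finset (Fin m)) : Set (Fin m)).PairwiseDisjoint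
      fun i => ({s(s i, p i), s(s i, p' i)} : Finset (Sym2 (Fin n))) := by
    intro i _ k _ hik
    rw [Function.onFun, Finset.disjoint_left]
    intro e hei hek
    simp only [Finset.mem_insert, Finset.mem_singleton] at hei hek
    have hsik : s i ≠ s k := fun h => hik (hs h)
    have aux : ∀ (x y : Fin n), (s(s i, x) : Sym2 (Fin n)) = s(s k, y) → (∀ l, y ≠ s l) → False := by
      intro x y h hy
      rcases Sym2.eq_iff.1 h with ⟨h1, _⟩ | ⟨h1, _⟩
      · exact hsik h1
      · exact hy i h1.symm
    rcases hei with rfl | rfl <;> rcases hek with h | h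
    · exact aux _ _ h (fun l => hps k l)
    · exact aux _ _ h (fun l => hp's k l)
    · exact aux _ _ h (fun l => hps k l)
    · exact aux _ _ h (fun l => hp's k l)
  have hCdet : ∀ i ∈ (Finset.univ : Finset (Fin m)),
      DeterminedBy (C i) (↑({s(s i, p i), s(s i, p' i)} : Finset (Sym2 (Fin n))) : Set (Sym2 (Fin n))) := by
    intro i _
    rw [determinedBy_iff]
    intro ω ω' hωω'
    have key : ∀ e ∈ ({s(s i, p i), s(s i, p' i)} : Finset (Sym2 (Fin n))), (e ∈ ω ↔ e ∈ ω') := by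
      intro e he
      have := Set.ext_iff.1 hωω' e
      simp only [mem_inter_iff, Finset.mem_coe, he, and_true] at this
      exact this
    simp only [hC, mem_setOf_eq]
    rw [key _ (by simp), key _ (by simp)]
  have hprod := prodBernoulli_real_inter_biInter_of_determinedBy w (Finset.univ : Finset (Fin m))
    (fun i => ({s(s i, p i), s(s i, p' i)} : Finset (Sym2 (Fin n)))) hSdisj hCdet
    (fun i _ => MeasurableSet.of_discrete) (A := Set.univ) (determinedBy_univ _) MeasurableSet.univ
  rw [hprod, probReal_univ, one_mul]
  refine Finset.prod_congr rfl fun i _ => ?_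
  have hsplit : C i = {ω | s(s i, p i) ∈ ω ↔ (t i).1 = true} ∩ {ω | s(s i, p' i) ∈ ω ↔ (t i).2 = true} := by
    ext ω; simp only [hC, mem_setOf_eq, mem_inter_iff]
  have hdet1 : DeterminedBy {ω : BondConfig (Fin n) | s(s i, p i) ∈ ω ↔ (t i).1 = true}
      (↑({s(s i, p i)} : Finset (Sym2 (Fin n))) : Set (Sym2 (Fin n))) := by
    rw [determinedBy_iff]
    intro ω ω' hωω'
    have := Set.ext_iff.1 hωω' s(s i, p i)
    simp only [mem_inter_iff, Finset.coe_singleton, mem_singleton_iff, and_true] at this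
    simp only [mem_setOf_eq, this]
  have hdet2 : DeterminedBy {ω : BondConfig (Fin n) | s(s i, p' i) ∈ ω ↔ (t i).2 = true}
      (↑({s(s i, p' i)} : Finset (Sym2 (Fin n))) : Set (Sym2 (Fin n))) := by
    rw [determinedBy_iff]
    intro ω ω' hωω'
    have := Set.ext_iff.1 hωω' s(s i, p' i)
    simp only [mem_inter_iff, Finset.coe_singleton, mem_singleton_iff, and_true] at this
    simp only [mem_setOf_eq, this]
  have hdisj1 : Disjoint ({s(s i, p i)} : Finset (Sym2 (Fin n))) {s(s i, p' i)} := by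
    rw [Finset.disjoint_singleton]; exact hne i
  rw [hsplit, prodBernoulli_real_inter_of_determinedBy_disjoint w hdisj1 hdet1 hdet2 MeasurableSet.of_discrete
    MeasurableSet.of_discrete]
  have hone : ∀ (e : Sym2 (Fin n)) (b : Bool), μ.real {ω : BondConfig (Fin n) | e ∈ ω ↔ b = true} =
      if b then (w e : ℝ) else 1 - w e := by
    intro e b
    cases b
    · simp only [Bool.false_eq_true, iff_false, if_false]
      exact prodBernoulli_real_setOf_notMem w e
    · simp only [iff_true, if_true]
      exact prodBernoulli_real_setOf_mem w e
  rw [hone, hone]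

/-- **State expansion of the separated margin of a two-port star family (ports may be shared across stars).**
`μ_w(c ↮ S, |π(c)| ≤ j) − μ_w(c ↮ S, 1 ≤ |π(S)| ≤ j) = Σ_t ι(t)·[μ_w(c ↮' Y(t), |π'(c)| ≤ j) − μ_w(c ↮' Y(t), 1 ≤ |π'(Y(t))| ≤ j)]`,
primes read on `ξ(ω) = ω ∩ {e | ∀ v ∈ S, v ∉ e}`, `S = {s i}`. [folklore] -/
theorem setCSdiff_state_expansion (w : Sym2 (Fin n) → unitInterval) (A : Finset (Fin n)) (s p p' : Fin m → Fin n) (c : Fin n)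
    (j : ℕ) (hs : Function.Injective s) (hsA : ∀ i, s i ∉ A) (hps : ∀ i k, p i ≠ s k) (hp's : ∀ i k, p' i ≠ s k)
    (hpp' : ∀ i, p i ≠ p' i) (hcs : ∀ i, c ≠ s i)
    (hwjunk : ∀ i u, u ≠ s i → u ≠ p i → u ≠ p' i → w s(s i, u) = 0) :
    (prodBernoulli w).real {ω : BondConfig (Fin n) | (∀ x ∈ Finset.univ.image s, ω ∉ openConn c x) ∧
        (A.filter fun z => ω ∈ openConn c z).card ≤ j} -
      (prodBernoulli w).real {ω : BondConfig (Fin n) | (∀ x ∈ Finset.univ.image s, ω ∉ openConn c x) ∧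
        1 ≤ (A.filter fun z => ∃ x ∈ Finset.univ.image s, ω ∈ openConn x z).card ∧
        (A.filter fun z => ∃ x ∈ Finset.univ.image s, ω ∈ openConn x z).card ≤ j} =
    ∑ t : Fin m → Bool × Bool,
      (∏ i, ((if (t i).1 then (w s(s i, p i) : ℝ) else 1 - w s(s i, p i)) *
        (if (t i).2 then (w s(s i, p' i) : ℝ) else 1 - w s(s i, p' i)))) *
      ((prodBernoulli w).real {ω : BondConfig (Fin n) |
          (∀ u ∈ (Finset.univ.filter fun i => (t i).1 = true).image p ∪ (Finset.univ.filter fun i => (t i).2 = true).image p',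
            ¬ (openGraph (ω ∩ {e | ∀ v ∈ Finset.univ.image s, v ∉ e})).Reachable c u) ∧
          (A.filter fun z => (openGraph (ω ∩ {e | ∀ v ∈ Finset.univ.image s, v ∉ e})).Reachable c z).card ≤ j} -
        (prodBernoulli w).real {ω : BondConfig (Fin n) |
          (∀ u ∈ (Finset.univ.filter fun i => (t i).1 = true).image p ∪ (Finset.univ.filter fun i => (t i).2 = true).image p',
            ¬ (openGraph (ω ∩ {e | ∀ v ∈ Finset.univ.image s, v ∉ e})).Reachable c u) ∧
          1 ≤ (A.filter fun z => ∃ u ∈ (Finset.univ.filter fun i => (t i).1 = true).image p ∪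
              (Finset.univ.filter fun i => (t i).2 = true).image p',
            (openGraph (ω ∩ {e | ∀ v ∈ Finset.univ.image s, v ∉ e})).Reachable u z).card ∧
          (A.filter fun z => ∃ u ∈ (Finset.univ.filter fun i => (t i).1 = true).image p ∪
              (Finset.univ.filter fun i => (t i).2 = true).image p',
            (openGraph (ω ∩ {e | ∀ v ∈ Finset.univ.image s, v ∉ e})).Reachable u z).card ≤ j}) := by
  haveI : IsProbabilityMeasure (prodBernoulli w) := inferInstance
  set μ := prodBernoulli w with hμ
  set S := Finset.univ.image s with hS
  set T : BondConfig (Fin n) → (Fin m → Bool × Bool) :=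
    fun ω i => (decide (s(s i, p i) ∈ ω), decide (s(s i, p' i) ∈ ω)) with hT
  set Yof : (Fin m → Bool × Bool) → Finset (Fin n) := fun t =>
    (Finset.univ.filter fun i => (t i).1 = true).image p ∪ (Finset.univ.filter fun i => (t i).2 = true).image p' with hYof
  -- junk pairs: off a null set the gate set is the port set of the state
  set J : Finset (Sym2 (Fin n)) :=
    (((Finset.univ : Finset (Fin m)) ×ˢ (Finset.univ : Finset (Fin n))).filter
      fun q => q.2 ≠ s q.1 ∧ q.2 ≠ p q.1 ∧ q.2 ≠ p' q.1).image fun q => s(s q.1, q.2) with hJ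
  set N : Set (BondConfig (Fin n)) := {ω | ∃ e ∈ J, e ∈ ω} with hN
  have hN0 : μ N = 0 := by
    have hle : μ.real N ≤ 0 := by
      refine le_trans (prodBernoulli_real_exists_mem_le_sum w J) (le_of_eq (Finset.sum_eq_zero fun e he => ?_))
      rw [hJ, Finset.mem_image] at he
      obtain ⟨q, hq, rfl⟩ := he
      rw [Finset.mem_filter] at hq
      rw [hwjunk q.1 q.2 hq.2.1 hq.2.2.1 hq.2.2.2]
      rfl
    exact (measureReal_eq_zero_iff (measure_ne_top _ _)).1 (le_antisymm hle measureReal_nonneg)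
  have hgate : ∀ ω : BondConfig (Fin n), ω ∉ N →
      (Finset.univ.filter fun u => u ∉ S ∧ ∃ v ∈ S, s(u, v) ∈ ω) = Yof (T ω) := by
    intro ω hω
    have hjunk : ∀ i u, u ≠ s i → s(s i, u) ∈ ω → u = p i ∨ u = p' i := by
      intro i u hu he
      by_contra hc
      push Not at hc
      refine hω ⟨s(s i, u), ?_, he⟩
      rw [hJ, Finset.mem_image]
      exact ⟨(i, u), Finset.mem_filter.2 ⟨Finset.mem_product.2 ⟨Finset.mem_univ _, Finset.mem_univ _⟩, hu, hc.1, hc.2⟩, rfl⟩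
    exact gateSet_eq_portSet ω s p p' (T ω) hps hp's hjunk (fun i => by simp only [hT, decide_eq_true_eq, and_self])
  have hSA : Disjoint S A := by
    rw [Finset.disjoint_left]
    intro x hx
    rw [hS, Finset.mem_image] at hx
    obtain ⟨i, -, rfl⟩ := hx
    exact hsA i
  have hcS : c ∉ S := by
    rw [hS, Finset.mem_image]; rintro ⟨i, -, hi⟩; exact hcs i hi.symm
  -- the two outer events, partitioned by the state
  set ER := {ω : BondConfig (Fin n) | (∀ x ∈ S, ω ∉ openConn c x) ∧ (A.filter fun z => ω ∈ openConn c z).card ≤ j} with hER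
  set EL := {ω : BondConfig (Fin n) | (∀ x ∈ S, ω ∉ openConn c x) ∧
    1 ≤ (A.filter fun z => ∃ x ∈ S, ω ∈ openConn x z).card ∧
    (A.filter fun z => ∃ x ∈ S, ω ∈ openConn x z).card ≤ j} with hEL
  set PR : Finset (Fin n) → BondConfig (Fin n) → Prop := fun Y ξ =>
    (∀ u ∈ Y, ¬ (openGraph ξ).Reachable c u) ∧ (A.filter fun z => (openGraph ξ).Reachable c z).card ≤ j with hPR
  set PL : Finset (Fin n) → BondConfig (Fin n) → Prop := fun Y ξ =>
    (∀ u ∈ Y, ¬ (openGraph ξ).Reachable c u) ∧ 1 ≤ (A.filter fun z => ∃ u ∈ Y, (openGraph ξ).Reachable u z).card ∧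
      (A.filter fun z => ∃ u ∈ Y, (openGraph ξ).Reachable u z).card ≤ j with hPL
  have keyR : ∀ t, μ.real (ER ∩ {ω | T ω = t}) =
      μ.real {ω | T ω = t} * μ.real {ω | PR (Yof t) (ω ∩ {e | ∀ v ∈ S, v ∉ e})} := by
    intro t
    have hag : μ.real (ER ∩ {ω | T ω = t}) = μ.real ({ω | T ω = t} ∩ {ω | PR (Yof t) (ω ∩ {e | ∀ v ∈ S, v ∉ e})}) := by
      apply measureReal_congr
      have hpt : ∀ ω : BondConfig (Fin n), ω ∉ N → (ω ∈ ER ∩ {ω | T ω = t} ↔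
          ω ∈ {ω | T ω = t} ∩ {ω | PR (Yof t) (ω ∩ {e | ∀ v ∈ S, v ∉ e})}) := by
        intro ω hω
        have hset := CutObserver.SetStar.setR_inter_gateEq A S (Yof t) c j hcS
        have hω' := Set.ext_iff.1 hset ω
        simp only [mem_inter_iff, mem_setOf_eq] at hω' ⊢
        constructor
        · rintro ⟨hE, hTt⟩
          have hg : (Finset.univ.filter fun u => u ∉ S ∧ ∃ v ∈ S, s(u, v) ∈ ω) = Yof t := by rw [hgate ω hω, hTt]
          exact ⟨hTt, (hω'.1 ⟨hE, hg⟩).2⟩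
        · rintro ⟨hTt, hP⟩
          have hg : (Finset.univ.filter fun u => u ∉ S ∧ ∃ v ∈ S, s(u, v) ∈ ω) = Yof t := by rw [hgate ω hω, hTt]
          exact ⟨(hω'.2 ⟨hg, hP⟩).1, hTt⟩
      refine ae_eq_set.2 ⟨measure_mono_null (fun ω hω => ?_) hN0, measure_mono_null (fun ω hω => ?_) hN0⟩
      · by_contra hZ; exact hω.2 ((hpt ω hZ).1 hω.1)
      · by_contra hZ; exact hω.2 ((hpt ω hZ).2 hω.1)
    rw [hag]
    -- independence: the state class is determined by the port pairs, the other event by the pairs off the stars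
    set PE : Finset (Sym2 (Fin n)) :=
      (Finset.univ.image fun i => (s(s i, p i) : Sym2 (Fin n))) ∪ Finset.univ.image fun i => (s(s i, p' i) : Sym2 (Fin n))
      with hPE
    set Foff : Finset (Sym2 (Fin n)) := Finset.univ.filter fun e : Sym2 (Fin n) => ∀ v ∈ S, v ∉ e with hFoff
    have hdisjF : Disjoint PE Foff := by
      rw [Finset.disjoint_left]
      intro e he he'
      rw [hFoff, Finset.mem_filter] at he'
      rw [hPE, Finset.mem_union, Finset.mem_image, Finset.mem_image] at he
      rcases he with ⟨i, -, rfl⟩ | ⟨i, -, rfl⟩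
      · exact he'.2 (s i) (Finset.mem_image_of_mem s (Finset.mem_univ i)) (Sym2.mem_mk_left _ _)
      · exact he'.2 (s i) (Finset.mem_image_of_mem s (Finset.mem_univ i)) (Sym2.mem_mk_left _ _)
    have hdetA : DeterminedBy {ω : BondConfig (Fin n) | T ω = t} (↑PE : Set (Sym2 (Fin n))) := by
      rw [determinedBy_iff]
      intro ω ω' hωω'
      have key : ∀ e ∈ PE, (e ∈ ω ↔ e ∈ ω') := by
        intro e he
        have := Set.ext_iff.1 hωω' e
        simp only [mem_inter_iff, Finset.mem_coe, he, and_true] at this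
        exact this
      have hTeq : T ω = T ω' := by
        funext i
        simp only [hT]
        rw [key _ (Finset.mem_union_left _ (Finset.mem_image_of_mem _ (Finset.mem_univ i))),
          key _ (Finset.mem_union_right _ (Finset.mem_image_of_mem _ (Finset.mem_univ i)))]
      simp only [mem_setOf_eq, hTeq]
    have hdetB : DeterminedBy {ω : BondConfig (Fin n) | PR (Yof t) (ω ∩ {e | ∀ v ∈ S, v ∉ e})} (↑Foff : Set (Sym2 (Fin n))) :=
      CutObserver.SetStar.determinedBy_off S (PR (Yof t))
    exact prodBernoulli_real_inter_of_determinedBy_disjoint w hdisjF hdetA hdetB MeasurableSet.of_discrete MeasurableSet.of_discrete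
  have keyL : ∀ t, μ.real (EL ∩ {ω | T ω = t}) =
      μ.real {ω | T ω = t} * μ.real {ω | PL (Yof t) (ω ∩ {e | ∀ v ∈ S, v ∉ e})} := by
    intro t
    have hag : μ.real (EL ∩ {ω | T ω = t}) = μ.real ({ω | T ω = t} ∩ {ω | PL (Yof t) (ω ∩ {e | ∀ v ∈ S, v ∉ e})}) := by
      apply measureReal_congr
      have hpt : ∀ ω : BondConfig (Fin n), ω ∉ N → (ω ∈ EL ∩ {ω | T ω = t} ↔
          ω ∈ {ω | T ω = t} ∩ {ω | PL (Yof t) (ω ∩ {e | ∀ v ∈ S, v ∉ e})}) := by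
        intro ω hω
        have hset := CutObserver.SetStar.setL_inter_gateEq A S (Yof t) c j hSA hcS
        have hω' := Set.ext_iff.1 hset ω
        simp only [mem_inter_iff, mem_setOf_eq] at hω' ⊢
        constructor
        · rintro ⟨hE, hTt⟩
          have hg : (Finset.univ.filter fun u => u ∉ S ∧ ∃ v ∈ S, s(u, v) ∈ ω) = Yof t := by rw [hgate ω hω, hTt]
          exact ⟨hTt, (hω'.1 ⟨hE, hg⟩).2⟩
        · rintro ⟨hTt, hP⟩
          have hg : (Finset.univ.filter fun u => u ∉ S ∧ ∃ v ∈ S, s(u, v) ∈ ω) = Yof t := by rw [hgate ω hω, hTt]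
          exact ⟨(hω'.2 ⟨hg, hP⟩).1, hTt⟩
      refine ae_eq_set.2 ⟨measure_mono_null (fun ω hω => ?_) hN0, measure_mono_null (fun ω hω => ?_) hN0⟩
      · by_contra hZ; exact hω.2 ((hpt ω hZ).1 hω.1)
      · by_contra hZ; exact hω.2 ((hpt ω hZ).2 hω.1)
    rw [hag]
    set PE : Finset (Sym2 (Fin n)) :=
      (Finset.univ.image fun i => (s(s i, p i) : Sym2 (Fin n))) ∪ Finset.univ.image fun i => (s(s i, p' i) : Sym2 (Fin n))
      with hPE
    set Foff : Finset (Sym2 (Fin n)) := Finset.univ.filter fun e : Sym2 (Fin n) => ∀ v ∈ S, v ∉ e with hFoff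
    have hdisjF : Disjoint PE Foff := by
      rw [Finset.disjoint_left]
      intro e he he'
      rw [hFoff, Finset.mem_filter] at he'
      rw [hPE, Finset.mem_union, Finset.mem_image, Finset.mem_image] at he
      rcases he with ⟨i, -, rfl⟩ | ⟨i, -, rfl⟩
      · exact he'.2 (s i) (Finset.mem_image_of_mem s (Finset.mem_univ i)) (Sym2.mem_mk_left _ _)
      · exact he'.2 (s i) (Finset.mem_image_of_mem s (Finset.mem_univ i)) (Sym2.mem_mk_left _ _)
    have hdetA : DeterminedBy {ω : BondConfig (Fin n) | T ω = t} (↑PE : Set (Sym2 (Fin n))) := by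
      rw [determinedBy_iff]
      intro ω ω' hωω'
      have key : ∀ e ∈ PE, (e ∈ ω ↔ e ∈ ω') := by
        intro e he
        have := Set.ext_iff.1 hωω' e
        simp only [mem_inter_iff, Finset.mem_coe, he, and_true] at this
        exact this
      have hTeq : T ω = T ω' := by
        funext i
        simp only [hT]
        rw [key _ (Finset.mem_union_left _ (Finset.mem_image_of_mem _ (Finset.mem_univ i))),
          key _ (Finset.mem_union_right _ (Finset.mem_image_of_mem _ (Finset.mem_univ i)))]
      simp only [mem_setOf_eq, hTeq]
    have hdetB : DeterminedBy {ω : BondConfig (Fin n) | PL (Yof t) (ω ∩ {e | ∀ v ∈ S, v ∉ e})} (↑Foff : Set (Sym2 (Fin n))) :=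
      CutObserver.SetStar.determinedBy_off S (PL (Yof t))
    exact prodBernoulli_real_inter_of_determinedBy_disjoint w hdisjF hdetA hdetB MeasurableSet.of_discrete MeasurableSet.of_discrete
  rw [measureReal_eq_sum_fiber μ T Finset.univ (fun _ => Finset.mem_univ _) ER,
    measureReal_eq_sum_fiber μ T Finset.univ (fun _ => Finset.mem_univ _) EL, ← Finset.sum_sub_distrib]
  refine Finset.sum_congr rfl fun t _ => ?_
  rw [keyR t, keyL t, ← mul_sub, real_stateClass_eq w s p p' t hs hps hp's hpp']

end StarSet

end Summit.CriticalPhenomena.PercolationContinuityZ3.Theorems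

end
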